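import Mathlib.Analysis.Complex.ExponentialBounds
import Summits.Ventures.WeilGRH.DualTrigMod25OddOne
import Summits.Ventures.WeilGRH.DualTrigCertMod25Class6One
import Summits.Ventures.WeilGRH.DualTrigCertMod25EvenRealOne
import Summits.Ventures.WeilGRH.DualTrigLatticeCertMod25Class4One
import Summits.Ventures.WeilGRH.DualTrigLatticeCertMod25Class9One
import Summits.Ventures.WeilGRH.DualTrigLatticeCertMod25Class11One
import Summits.Ventures.WeilGRH.RealCharacterSmallModuli
import HarnessLib

/-!
# Every non-principal Dirichlet character mod 25: Weil positivity on `[−1, 1]`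

Cell `rh-explicit`, WEIL TRACK — GRH ARM, route B (weil-grh-3, gen18).  Assembly (no kernel work) of the format-D-K `t = 1`
theorems of modulus 25: the odd assembly `weilPositivityOnChar_mod25_one_of_odd` (gen15/17, ten characters), the even real
character `(5/·)∘` (`weilPositivityOnChar_mod25_even_chi2_neg_one`), the even complex class `25.6/25.21`
(`weilPositivityOnChar_mod25_class6_one[_conj]`, format D-K window door) and the three even complex classes `25.4/25.19`,
`25.9/25.14`, `25.11/25.16` (`DualTrigLatticeCertMod25Class{4,9,11}One`, format D-K v3 = multi-lattice tail).  Since `2` generates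
`(ℤ/25)ˣ` (`RealCharacterSmallModuli.units_mod_twentyfive_gen`), `χ(2) = e(k/20)` with `k < 20`: `k = 0` is the principal character
(excluded — it fails at `t = 1`, `UniformFloor.not_weilPositivityOnChar_one_principal` for small moduli), odd `k` are the odd
characters, `k = 10` the real one, and `k = 2, 18 / 4, 16 / 6, 14 / 8, 12` the four even complex classes.
Headline: `weilPositivityOnChar_mod25_one_of_ne_one` — for EVERY Dirichlet character `χ ≠ 1` mod 25 and every smooth `g`
supported in `[−1, 1]`, `Re W_χ(g ⋆ g̃) ≥ 0`; with the tree's level-raising (`InducedCharacter.lean`) the same holds for every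
non-principal character of conductor 5 or 25 at any level.  Context: 25 ∈ R₀, the explicit finite remainder of the arm's uniform
`t = 1` floor (`UniformConductorFloorCoprimeRemainder`).  Honest scope: a theorem for these 19 characters and this window only.
No named facts, no `sorry`; axioms standard.
-/

namespace Summit.Ventures.WeilGRH

open Literature.NumberTheory.LFunctions

/-- `exp (2πi/20)^10 = −1`. [folklore] -/
theorem exp_twentieth_pow_ten : Complex.exp (2 * Real.pi * Complex.I / 20) ^ 10 = -1 := by
  rw [← Complex.exp_nat_mul, show ((10 : ℕ) : ℂ) * (2 * Real.pi * Complex.I / 20) = Real.pi * Complex.I by push_cast; ring]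
  exact Complex.exp_pi_mul_I

/-- An odd exponent at the generator makes the character odd: `χ(2) = ζ₂₀^(2m+1)` ⟹ `χ(−1) = χ(2)¹⁰ = −1`. [folklore] -/
theorem odd_of_apply_two_mod25 (χ : DirichletCharacter ℂ 25) {m : ℕ}
    (hζ : Complex.exp (2 * Real.pi * Complex.I / 20) ^ (2 * m + 1) = χ 2) : χ.Odd := by
  have h1 : Complex.exp (2 * Real.pi * Complex.I / 20) ^ 20 = 1 := by
    exact_mod_cast (Complex.isPrimitiveRoot_exp 20 (by norm_num)).pow_eq_one
  show χ (-1) = -1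
  rw [show (-1 : ZMod 25) = 2 ^ 10 by decide, map_pow, ← hζ, ← pow_mul,
    show (2 * m + 1) * 10 = 20 * m + 10 by ring, pow_add, pow_mul, h1, one_pow, one_mul, exp_twentieth_pow_ten]

/-- **Every NON-PRINCIPAL Dirichlet character mod 25 satisfies Weil positivity on `[−1, 1]`.**  `χ(2) = e(k/20)`, `k < 20`:
`k = 0` contradicts `χ ≠ 1`; odd `k` ⟹ `χ` odd (odd assembly); `k = 10` ⟹ `χ(2) = −1` (even real); `k = 2, 18` the class
`25.4/25.19`, `k = 4, 16` the class `25.16/25.11`… precisely `k = 4` ↦ `25.16` (`e(1/5)`), `16` ↦ `25.11` (`e(−1/5)`), `6` ↦ `25.14`,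
`14` ↦ `25.9`, `8` ↦ `25.6`, `12` ↦ `25.21` — nineteen kernel-certified characters, one per case. [folklore] -/
theorem weilPositivityOnChar_mod25_one_of_ne_one (χ : DirichletCharacter ℂ 25) (hχ : χ ≠ 1) :
    WeilPositivityOnChar χ 1 := by
  have h20 : χ (2 : ZMod 25) ^ 20 = 1 := by
    rw [← map_pow, show (2 : ZMod 25) ^ 20 = 1 by decide, map_one]
  have hprim : IsPrimitiveRoot (Complex.exp (2 * Real.pi * Complex.I / 20)) 20 :=
    Complex.isPrimitiveRoot_exp 20 (by norm_num)
  obtain ⟨k, hk, hζ⟩ := hprim.eq_pow_of_pow_eq_one h20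
  interval_cases k
  · exact absurd (RealCharacterSmallModuli.eq_one_of_apply_gen RealCharacterSmallModuli.units_mod_twentyfive_gen
      (show χ (2 : ZMod 25) = 1 by rw [← hζ, pow_zero])) hχ
  · exact weilPositivityOnChar_mod25_one_of_odd χ (odd_of_apply_two_mod25 χ (m := 0) (by simpa using hζ))
  · refine weilPositivityOnChar_mod25_class4_one χ ?_
    rw [← hζ, exp_twentieth_pow, Complex.exp_eq_exp_iff_exists_int]
    exact ⟨0, by push_cast; ring⟩
  · exact weilPositivityOnChar_mod25_one_of_odd χ (odd_of_apply_two_mod25 χ (m := 1) (by simpa using hζ))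
  · refine weilPositivityOnChar_mod25_class11_one_conj χ ?_
    rw [← hζ, exp_twentieth_pow, Complex.exp_eq_exp_iff_exists_int]
    exact ⟨0, by push_cast; ring⟩
  · exact weilPositivityOnChar_mod25_one_of_odd χ (odd_of_apply_two_mod25 χ (m := 2) (by simpa using hζ))
  · refine weilPositivityOnChar_mod25_class9_one_conj χ ?_
    rw [← hζ, exp_twentieth_pow, Complex.exp_eq_exp_iff_exists_int]
    exact ⟨0, by push_cast; ring⟩
  · exact weilPositivityOnChar_mod25_one_of_odd χ (odd_of_apply_two_mod25 χ (m := 3) (by simpa using hζ))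
  · refine weilPositivityOnChar_mod25_class6_one χ ?_
    rw [← hζ, exp_twentieth_pow, Complex.exp_eq_exp_iff_exists_int]
    exact ⟨0, by push_cast; ring⟩
  · exact weilPositivityOnChar_mod25_one_of_odd χ (odd_of_apply_two_mod25 χ (m := 4) (by simpa using hζ))
  · exact weilPositivityOnChar_mod25_even_chi2_neg_one χ (by rw [← hζ, exp_twentieth_pow_ten])
  · exact weilPositivityOnChar_mod25_one_of_odd χ (odd_of_apply_two_mod25 χ (m := 5) (by simpa using hζ))
  · refine weilPositivityOnChar_mod25_class6_one_conj χ ?_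
    rw [← hζ, exp_twentieth_pow, Complex.exp_eq_exp_iff_exists_int]
    exact ⟨1, by push_cast; ring⟩
  · exact weilPositivityOnChar_mod25_one_of_odd χ (odd_of_apply_two_mod25 χ (m := 6) (by simpa using hζ))
  · refine weilPositivityOnChar_mod25_class9_one χ ?_
    rw [← hζ, exp_twentieth_pow, Complex.exp_eq_exp_iff_exists_int]
    exact ⟨1, by push_cast; ring⟩
  · exact weilPositivityOnChar_mod25_one_of_odd χ (odd_of_apply_two_mod25 χ (m := 7) (by simpa using hζ))
  · refine weilPositivityOnChar_mod25_class11_one χ ?_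
    rw [← hζ, exp_twentieth_pow, Complex.exp_eq_exp_iff_exists_int]
    exact ⟨1, by push_cast; ring⟩
  · exact weilPositivityOnChar_mod25_one_of_odd χ (odd_of_apply_two_mod25 χ (m := 8) (by simpa using hζ))
  · refine weilPositivityOnChar_mod25_class4_one_conj χ ?_
    rw [← hζ, exp_twentieth_pow, Complex.exp_eq_exp_iff_exists_int]
    exact ⟨1, by push_cast; ring⟩
  · exact weilPositivityOnChar_mod25_one_of_odd χ (odd_of_apply_two_mod25 χ (m := 9) (by simpa using hζ))

/-- **Every non-principal Dirichlet character mod 25: Weil positivity on every window `[−t, t]`, `t ≤ 1`.** [folklore] -/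
theorem weilPositivityOnChar_mod25_of_le_one_of_ne_one (χ : DirichletCharacter ℂ 25) (hχ : χ ≠ 1) {t : ℝ} (ht : t ≤ 1) :
    WeilPositivityOnChar χ t :=
  (weilPositivityOnChar_mod25_one_of_ne_one χ hχ).mono ht

end Summit.Ventures.WeilGRH
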